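import Mathlib
import HarnessLib
import Summits.Ventures.LatticeQCDFlow.Scoring.SplitChainTourMoments
import Summits.Ventures.LatticeQCDFlow.Scoring.SplitChainResidualMoves

/-!
# Tours of the split chain, IV: KAC'S CYCLE FORMULA `E[Y^f_0] = π(f)/ε` for the first tour of the
# fresh split chain, the centred tour sum has mean zero, and its second moment is `≤ C² (2 − ε)/ε²`

HONEST FRAMING: exact (Metropolis-corrected) sampling algorithms for lattice gauge theory;
figures of merit are autocorrelation/cost numbers at stated couplings and volumes; no
continuum-physics claim.

Venture `LatticeQCDFlow` (cell pub-lqcd), topic `Scoring`; FANOUT row 8 (`s0-cpn-nemc`, GEN-16).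
NEW WORK of the cell, not a published result; no definition is introduced.  Notation of
`Scoring/SplitChainTours.lean`; `Y^f_0 := ∑' u, 1{K_u = 0} f(X_u)` is the occupation of `f` over the
first tour and `N_0` its length.  The truncated cycle formula of
`Scoring/SplitChainResidualMoves.lean` (`E[1{K_u = 0} f(X_u)] = (1 − ε)^u ν(R^u f)` from the fresh
start `ν ⊗ δ_true`, and the Doeblin series of an invariant `π`) is summed: `Y^f_0` is integrable and
`E[Y^f_0] = π(f)/ε` — KAC'S / THE REGENERATIVE CYCLE FORMULA `π(f) = E[Y^f_0]/E[N_0]`; hence the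
centred tour sum `Z_0 = Y^{f − π(f)}_0` has mean zero, and from `|Y^g_0| ≤ C_g N_0` (a.s.) and
`E[N_0²] = (2 − ε)/ε²` (`Scoring/SplitChainTourMoments.lean`), `E[(Y^g_0)²] ≤ C_g² (2 − ε)/ε²`.
Printed counterpart NAMED ONLY: Kac 1947; Nummelin 1984 §5; Meyn–Tweedie 1993 Thm 10.0.1;
Asmussen 2003 VI.1; Mykland–Tierney–Yu 1995; Hobert–Jones–Presnell–Rosenthal 2002 — nothing is
cited as a fact.

## Content (`e = ε.toReal`; `0 < ε < 1`)

* **`splitChain_fresh_integral_tourSum`** — fresh start, `π` invariant, `|f| ≤ C` measurable: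
  `Y^f_0` is integrable and `E[Y^f_0] = π(f)/e`;
* **`splitChain_fresh_integral_centredTourSum`** — `Z_0 = ∑' u, 1{K_u = 0} (f(X_u) − π(f))` is
  integrable with `E[Z_0] = 0`;
* **`splitChain_fresh_sq_tourSum_le`** — any initial law, `|g| ≤ C_g` measurable: `(Y^g_0)²` is
  integrable and `E[(Y^g_0)²] ≤ C_g² (2 − e)/e²`.

NOT CLAIMED: the estimator's error bar (next file); any `ε` of a concrete sampler.
-/

noncomputable section

namespace Summit.Ventures.LatticeQCDFlow.Scoring

open MeasureTheory ProbabilityTheory Filter Finset Preorder Literature.Probability.MarkovChains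
open scoped ENNReal

section Cycle

variable {Ω : Type*} [MeasurableSpace Ω]
  {κ : Kernel Ω Ω} [IsMarkovKernel κ] {ν : Measure Ω} [IsProbabilityMeasure ν] {ε : ℝ≥0∞}
  {hmin : ∀ x {B : Set Ω}, MeasurableSet B → ε * ν B ≤ κ x B}
  (κs : Kernel (Ω × Bool) (Ω × Bool)) [IsMarkovKernel κs]
  (μs : Measure (Ω × Bool)) [IsProbabilityMeasure μs]

/-- **KAC / THE CYCLE FORMULA**: for `π` invariant, `0 < ε < 1`, `|f| ≤ C` measurable, the tour sum
`Y^f_0 = ∑' u, 1{K_u = 0} f(X_u)` of the fresh split chain is integrable with `E[Y^f_0] = π(f)/e`. -/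
theorem splitChain_fresh_integral_tourSum {π : Measure Ω} [IsProbabilityMeasure π]
    (hπ : Kernel.Invariant κ π) (hε0 : 0 < ε) (hε : ε < 1)
    (hκs : ∀ p, κs p = (ε • ν).map (fun y : Ω => (y, true))
      + ((1 - ε) • Doeblin.residualKernel κ ν ε hmin p.1).map (fun y : Ω => (y, false)))
    {f : Ω → ℝ} (hf : Measurable f) {C : ℝ} (hC : ∀ x, |f x| ≤ C) :
    Integrable (fun x : ℕ → Ω × Bool => ∑' u, (if (∑ s ∈ Finset.range u,
        (if (x (s + 1)).2 then (1 : ℕ) else 0)) = 0 then (1 : ℝ) else 0) * f (x u).1)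
      (Kernel.trajMeasure (X := fun _ : ℕ => Ω × Bool) (ν.map (fun y : Ω => (y, true)))
        (fun n : ℕ => κs.comap (fun h : (i : ↥(Finset.Iic n)) → Ω × Bool =>
          h ⟨n, Finset.mem_Iic.2 le_rfl⟩) (measurable_pi_apply _)))
    ∧ ∫ x, ∑' u, (if (∑ s ∈ Finset.range u, (if (x (s + 1)).2 then (1 : ℕ) else 0)) = 0
        then (1 : ℝ) else 0) * f (x u).1
        ∂(Kernel.trajMeasure (X := fun _ : ℕ => Ω × Bool) (ν.map (fun y : Ω => (y, true)))
          (fun n : ℕ => κs.comap (fun h : (i : ↥(Finset.Iic n)) → Ω × Bool =>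
            h ⟨n, Finset.mem_Iic.2 le_rfl⟩) (measurable_pi_apply _)))
      = (∫ x, f x ∂π) / ε.toReal := by
  haveI hνt : IsProbabilityMeasure (ν.map (fun y : Ω => (y, true))) :=
    Measure.isProbabilityMeasure_map (measurable_tagCoin true).aemeasurable
  haveI := Doeblin.isMarkovKernel_residualKernel (κ := κ) (ν := ν) (hmin := hmin) hε
  set P := Kernel.trajMeasure (X := fun _ : ℕ => Ω × Bool) (ν.map (fun y : Ω => (y, true)))
      (fun n : ℕ => κs.comap (fun h : (i : ↥(Finset.Iic n)) → Ω × Bool =>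
        h ⟨n, Finset.mem_Iic.2 le_rfl⟩) (measurable_pi_apply _)) with hP
  have he0 : 0 < ε.toReal := ENNReal.toReal_pos hε0.ne' (ne_top_of_lt hε)
  have he1 : ε.toReal ≤ 1 := by
    have := (ENNReal.toReal_lt_toReal (ne_top_of_lt hε) ENNReal.one_ne_top).2 hε
    rw [ENNReal.toReal_one] at this
    exact this.le
  have hC0 : 0 ≤ C := (abs_nonneg _).trans (hC (Classical.choice (nonempty_of_isProbabilityMeasure ν)))
  -- each term: `E[1{K_u = 0} f(X_u)] = (1 - e)^u ν(R^u f)`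
  have hterm : ∀ u, ∫ x, (if (∑ s ∈ Finset.range u, (if (x (s + 1)).2 then (1 : ℕ) else 0)) = 0
      then (1 : ℝ) else 0) * f (x u).1 ∂P
      = (1 - ε.toReal) ^ u * ∫ y, (kop (Doeblin.residualKernel κ ν ε hmin))^[u] f y ∂ν := by
    intro u
    simp_rw [headCount_eq_zero_indicator]
    rw [hP]
    exact splitChain_fresh_tailsRun_move κs (κ := κ) (ν := ν) (hmin := hmin) hε hκs hf hC u
  have hint : ∀ u, Integrable (fun x : ℕ → Ω × Bool => (if (∑ s ∈ Finset.range u,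
      (if (x (s + 1)).2 then (1 : ℕ) else 0)) = 0 then (1 : ℝ) else 0) * f (x u).1) P := fun u =>
    integrable_of_bounded P ((measurable_headCountIndicator u 0).mul
      (hf.comp (measurable_fst.comp (measurable_pi_apply u)))) (C := 1 * C) fun x => by
      rw [abs_mul]
      exact mul_le_mul (by split_ifs <;> simp) (hC _) (abs_nonneg _) zero_le_one
  -- the norms are dominated by `C (1 - e)^u`
  have hnorm_le : ∀ u, ∫ x, ‖(if (∑ s ∈ Finset.range u, (if (x (s + 1)).2 then (1 : ℕ) else 0)) = 0
      then (1 : ℝ) else 0) * f (x u).1‖ ∂P ≤ C * (1 - ε.toReal) ^ u := by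
    intro u
    have hTu : ∫ x, (if (∑ s ∈ Finset.range u, (if (x (s + 1)).2 then (1 : ℕ) else 0)) = 0
        then (1 : ℝ) else 0) ∂P = (1 - ε.toReal) ^ u := by
      simp_rw [headCount_eq_zero_indicator]
      rw [hP]
      exact splitChain_fresh_tailsRun κs (κ := κ) (ν := ν) (hmin := hmin) hε hκs u
    calc ∫ x, ‖(if (∑ s ∈ Finset.range u, (if (x (s + 1)).2 then (1 : ℕ) else 0)) = 0
          then (1 : ℝ) else 0) * f (x u).1‖ ∂P
        ≤ ∫ x, C * (if (∑ s ∈ Finset.range u, (if (x (s + 1)).2 then (1 : ℕ) else 0)) = 0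
          then (1 : ℝ) else 0) ∂P := by
          refine integral_mono (hint u).norm ((integrable_of_bounded P
            (measurable_headCountIndicator u 0) (C := 1) fun x => by split_ifs <;> simp).const_mul C)
            fun x => ?_
          beta_reduce
          have hi0 : 0 ≤ (if (∑ s ∈ Finset.range u, (if (x (s + 1)).2 then (1 : ℕ) else 0)) = 0
              then (1 : ℝ) else 0) := by split_ifs <;> norm_num
          rw [Real.norm_eq_abs, abs_mul, abs_of_nonneg hi0]
          calc _ ≤ (if (∑ s ∈ Finset.range u, (if (x (s + 1)).2 then (1 : ℕ) else 0)) = 0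
                then (1 : ℝ) else 0) * C := mul_le_mul_of_nonneg_left (hC _) hi0
            _ = _ := mul_comm _ _
      _ = C * (1 - ε.toReal) ^ u := by rw [integral_const_mul, hTu]
  have hsum : Summable fun u => ∫ x, ‖(if (∑ s ∈ Finset.range u,
      (if (x (s + 1)).2 then (1 : ℕ) else 0)) = 0 then (1 : ℝ) else 0) * f (x u).1‖ ∂P :=
    Summable.of_nonneg_of_le (fun u => integral_nonneg fun x => norm_nonneg _) hnorm_le
      ((summable_geometric_of_lt_one (by linarith) (by linarith)).mul_left C)
  refine ⟨integrable_tsum_of_summable_integral_norm P hint hsum, ?_⟩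
  rw [← integral_tsum_of_summable_integral_norm hint hsum]
  simp_rw [hterm]
  -- the Doeblin series: partial sums converge to `π(f)/e`
  have hsum' : Summable fun u : ℕ => (1 - ε.toReal) ^ u
      * ∫ y, (kop (Doeblin.residualKernel κ ν ε hmin))^[u] f y ∂ν := by
    refine Summable.of_norm_bounded ((summable_geometric_of_lt_one (by linarith)
      (by linarith : 1 - ε.toReal < 1)).mul_left C) fun u => ?_
    obtain ⟨-, hb⟩ := iterate_kop_bounded_measurable (Doeblin.residualKernel κ ν ε hmin) hf hC u
    rw [Real.norm_eq_abs, abs_mul, abs_of_nonneg (pow_nonneg (by linarith) u), mul_comm]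
    refine mul_le_mul_of_nonneg_right ?_ (pow_nonneg (by linarith) u)
    calc |∫ y, (kop (Doeblin.residualKernel κ ν ε hmin))^[u] f y ∂ν|
        = ‖∫ y, (kop (Doeblin.residualKernel κ ν ε hmin))^[u] f y ∂ν‖ := (Real.norm_eq_abs _).symm
      _ ≤ C * ν.real Set.univ := norm_integral_le_of_norm_le_const (Eventually.of_forall fun y => by
          rw [Real.norm_eq_abs]; exact hb y)
      _ = C := by rw [probReal_univ, mul_one]
  have hlim : Tendsto (fun n : ℕ => ∑ u ∈ Finset.range n, (1 - ε.toReal) ^ u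
      * ∫ y, (kop (Doeblin.residualKernel κ ν ε hmin))^[u] f y ∂ν) atTop
      (nhds ((∫ x, f x ∂π) / ε.toReal)) := by
    rw [tendsto_iff_norm_sub_tendsto_zero]
    refine squeeze_zero_norm (a := fun n : ℕ => (1 - ε.toReal) ^ n * (C / ε.toReal))
      (fun n => ?_) ?_
    · have h := doeblin_series_remainder_le (κ := κ) (ν := ν) (hmin := hmin) hπ hε hf hC n
      rw [norm_norm, Real.norm_eq_abs]
      have heq : (∑ u ∈ Finset.range n, (1 - ε.toReal) ^ u
          * ∫ y, (kop (Doeblin.residualKernel κ ν ε hmin))^[u] f y ∂ν) - (∫ x, f x ∂π) / ε.toReal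
          = -((∫ x, f x ∂π - ε.toReal * ∑ u ∈ Finset.range n, (1 - ε.toReal) ^ u
            * ∫ y, (kop (Doeblin.residualKernel κ ν ε hmin))^[u] f y ∂ν) / ε.toReal) := by
        field_simp
        ring
      rw [heq, abs_neg, abs_div, abs_of_pos he0, div_le_iff₀ he0]
      calc _ ≤ (1 - ε.toReal) ^ n * C := h
        _ = (1 - ε.toReal) ^ n * (C / ε.toReal) * ε.toReal := by field_simp
    · have h0 := (tendsto_pow_atTop_nhds_zero_of_lt_one (by linarith)
        (by linarith : 1 - ε.toReal < 1)).mul_const (C / ε.toReal)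
      rwa [zero_mul] at h0
  exact tendsto_nhds_unique hsum'.hasSum.tendsto_sum_nat hlim

/-- **The centred tour sum has mean zero**: with `Z_0 := ∑' u, 1{K_u = 0} (f(X_u) − π(f))`,
`E_{P̂_ν̂}[Z_0] = 0` (and `Z_0` is integrable). -/
theorem splitChain_fresh_integral_centredTourSum {π : Measure Ω} [IsProbabilityMeasure π]
    (hπ : Kernel.Invariant κ π) (hε0 : 0 < ε) (hε : ε < 1)
    (hκs : ∀ p, κs p = (ε • ν).map (fun y : Ω => (y, true))
      + ((1 - ε) • Doeblin.residualKernel κ ν ε hmin p.1).map (fun y : Ω => (y, false)))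
    {f : Ω → ℝ} (hf : Measurable f) {C : ℝ} (hC : ∀ x, |f x| ≤ C) :
    Integrable (fun x : ℕ → Ω × Bool => ∑' u, (if (∑ s ∈ Finset.range u,
        (if (x (s + 1)).2 then (1 : ℕ) else 0)) = 0 then (1 : ℝ) else 0)
        * (f (x u).1 - ∫ z, f z ∂π))
      (Kernel.trajMeasure (X := fun _ : ℕ => Ω × Bool) (ν.map (fun y : Ω => (y, true)))
        (fun n : ℕ => κs.comap (fun h : (i : ↥(Finset.Iic n)) → Ω × Bool =>
          h ⟨n, Finset.mem_Iic.2 le_rfl⟩) (measurable_pi_apply _)))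
    ∧ ∫ x, ∑' u, (if (∑ s ∈ Finset.range u, (if (x (s + 1)).2 then (1 : ℕ) else 0)) = 0
        then (1 : ℝ) else 0) * (f (x u).1 - ∫ z, f z ∂π)
        ∂(Kernel.trajMeasure (X := fun _ : ℕ => Ω × Bool) (ν.map (fun y : Ω => (y, true)))
          (fun n : ℕ => κs.comap (fun h : (i : ↥(Finset.Iic n)) → Ω × Bool =>
            h ⟨n, Finset.mem_Iic.2 le_rfl⟩) (measurable_pi_apply _))) = 0 := by
  have hfi : |∫ z, f z ∂π| ≤ C := by
    calc |∫ z, f z ∂π| = ‖∫ z, f z ∂π‖ := (Real.norm_eq_abs _).symm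
      _ ≤ C * π.real Set.univ := norm_integral_le_of_norm_le_const (Eventually.of_forall fun y => by
          rw [Real.norm_eq_abs]; exact hC y)
      _ = C := by rw [probReal_univ, mul_one]
  have hg : Measurable fun y => f y - ∫ z, f z ∂π := hf.sub_const _
  have hCg : ∀ y, |f y - ∫ z, f z ∂π| ≤ C + C := fun y =>
    (abs_sub _ _).trans (add_le_add (hC y) hfi)
  obtain ⟨hI, hE⟩ := splitChain_fresh_integral_tourSum κs (κ := κ) (ν := ν) (hmin := hmin) hπ hε0
    hε hκs hg hCg
  refine ⟨hI, ?_⟩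
  rw [hE, integral_sub (integrable_of_bounded π hf hC) (integrable_const _), integral_const,
    probReal_univ, one_smul, sub_self, zero_div]

/-- **Second moment of a tour sum**: for `|g| ≤ C_g` measurable, `(Y^g_0)²` is integrable under the
fresh split chain and `E[(Y^g_0)²] ≤ C_g² · (2 − e)/e²` (since `|Y^g_0| ≤ C_g N_0` almost surely). -/
theorem splitChain_fresh_sq_tourSum_le (hε0 : 0 < ε) (hε : ε < 1)
    (hκs : ∀ p, κs p = (ε • ν).map (fun y : Ω => (y, true))
      + ((1 - ε) • Doeblin.residualKernel κ ν ε hmin p.1).map (fun y : Ω => (y, false)))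
    {g : Ω → ℝ} (hg : Measurable g) {Cg : ℝ} (hCg : ∀ x, |g x| ≤ Cg) :
    Integrable (fun x : ℕ → Ω × Bool => (∑' u, (if (∑ s ∈ Finset.range u,
        (if (x (s + 1)).2 then (1 : ℕ) else 0)) = 0 then (1 : ℝ) else 0) * g (x u).1) ^ 2)
      (Kernel.trajMeasure (X := fun _ : ℕ => Ω × Bool) μs
        (fun n : ℕ => κs.comap (fun h : (i : ↥(Finset.Iic n)) → Ω × Bool =>
          h ⟨n, Finset.mem_Iic.2 le_rfl⟩) (measurable_pi_apply _)))
    ∧ ∫ x, (∑' u, (if (∑ s ∈ Finset.range u, (if (x (s + 1)).2 then (1 : ℕ) else 0)) = 0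
        then (1 : ℝ) else 0) * g (x u).1) ^ 2
        ∂(Kernel.trajMeasure (X := fun _ : ℕ => Ω × Bool) μs
          (fun n : ℕ => κs.comap (fun h : (i : ↥(Finset.Iic n)) → Ω × Bool =>
            h ⟨n, Finset.mem_Iic.2 le_rfl⟩) (measurable_pi_apply _)))
      ≤ Cg ^ 2 * ((2 - ε.toReal) / ε.toReal ^ 2) := by
  set P := Kernel.trajMeasure (X := fun _ : ℕ => Ω × Bool) μs
      (fun n : ℕ => κs.comap (fun h : (i : ↥(Finset.Iic n)) → Ω × Bool =>
        h ⟨n, Finset.mem_Iic.2 le_rfl⟩) (measurable_pi_apply _)) with hP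
  obtain ⟨hI, hE⟩ := splitChain_integral_sq_tourLength_zero κs μs (κ := κ) (ν := ν) (hmin := hmin)
    hε0 hε hκs
  rw [← hP] at hI hE
  have hψ : Measurable fun pq : (Ω × Bool) × (Ω × Bool) => g pq.1.1 :=
    hg.comp (measurable_fst.comp measurable_fst)
  have hYm := (measurable_tourSum (Ω := Ω) (ψ := fun p _ => g p.1) hψ 0).pow_const 2
  have hae : ∀ᵐ x ∂P, ‖(∑' u, (if (∑ s ∈ Finset.range u, (if (x (s + 1)).2 then (1 : ℕ) else 0)) = 0
      then (1 : ℝ) else 0) * g (x u).1) ^ 2‖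
      ≤ Cg ^ 2 * (∑' u, (if (∑ s ∈ Finset.range u, (if (x (s + 1)).2 then (1 : ℕ) else 0)) = 0
        then (1 : ℝ) else 0)) ^ 2 := by
    filter_upwards [splitChain_ae_tourStart κs μs (κ := κ) (ν := ν) (hmin := hmin) hε0 hε hκs]
      with x hx
    obtain ⟨t, ht, hh⟩ := hx 0
    have hb := abs_tourSum_le_tourLength (ψ := fun p _ => g p.1) (fun p _ => hCg p.1) x le_rfl ht hh
    rw [Real.norm_eq_abs, abs_pow, ← mul_pow]
    exact pow_le_pow_left₀ (abs_nonneg _) hb 2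
  refine ⟨Integrable.mono' (hI.const_mul (Cg ^ 2)) hYm.aestronglyMeasurable hae, ?_⟩
  calc ∫ x, (∑' u, (if (∑ s ∈ Finset.range u, (if (x (s + 1)).2 then (1 : ℕ) else 0)) = 0
        then (1 : ℝ) else 0) * g (x u).1) ^ 2 ∂P
      ≤ ∫ x, Cg ^ 2 * (∑' u, (if (∑ s ∈ Finset.range u, (if (x (s + 1)).2 then (1 : ℕ) else 0)) = 0
        then (1 : ℝ) else 0)) ^ 2 ∂P := by
        refine integral_mono_ae (Integrable.mono' (hI.const_mul (Cg ^ 2)) hYm.aestronglyMeasurable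
          hae) (hI.const_mul (Cg ^ 2)) ?_
        filter_upwards [hae] with x hx
        rw [Real.norm_eq_abs, abs_of_nonneg (sq_nonneg _)] at hx
        exact hx
    _ = Cg ^ 2 * ((2 - ε.toReal) / ε.toReal ^ 2) := by rw [integral_const_mul, hE]

end Cycle

end Summit.Ventures.LatticeQCDFlow.Scoring

end
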